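import Summits.ResolutionOfSingularities.ResolutionOfSingularities.Theorems.FrobeniusLadderFInjectiveMacaulayficationBadMaximalPoints
import Summits.ResolutionOfSingularities.ResolutionOfSingularities.Theorems.FrobeniusLadderFInjectiveMacaulayficationMeasureDescent
import Summits.ResolutionOfSingularities.ResolutionOfSingularities.Theorems.FrobeniusLadderFInjectiveMacaulayficationMaximalBadPoint
import Summits.ResolutionOfSingularities.ResolutionOfSingularities.Theorems.FrobeniusLadderFInjectiveMacaulayficationIsoLocusTransport
import Mathlib.AlgebraicGeometry.Noetherian
import Mathlib.AlgebraicGeometry.Morphisms.FiniteType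
import HarnessLib

/-!
# Hole #3 from super-strongly confined steps: termination is free (crux `FInjectiveMacaulayfication`)

[OURS · L1 W4.5a] Support file for crux stmt-ResolutionOfSingularities-15315
(`Summit.ResolutionOfSingularities.ResolutionOfSingularities.Theses.FrobeniusLadder.FInjectiveMacaulayfication`, route
`FrobeniusLadder`, skeleton v11 `86e9127b5c98b8e6`), hole #3 = registered stub `stub_genericFInjectivization` (an integral everywhere-CM
admissible `X₁/k` has a proper birational integral everywhere-CM model on which the Frobenius clause holds at every NON-CLOSED point).

**Composition of record for the termination half of hole #3.**  `genericFInjectivization_of_superStrongStep`: the registered signature of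
`stub_genericFInjectivization` follows VERBATIM from
* `hDM` = the registered signature of stub #2 `stub_fiLocusOpen` (the Datta–Murayama named fact, discharged in the crux composition
  `OfFacts`: the Frobenius-clause locus of an l.f.t. `k`-scheme with CM stalks is open), and
* `step` = SUPER-STRONGLY CONFINED STEPS: at every non-closed point `η` of an admissible `X₁` which fails the Frobenius clause and is
  maximal among such under generization, a proper birational `π : X₂ ⟶ X₁` with `X₂` admissible which is an ISOMORPHISM OVER
  `X₁ ∖ closure {η}` and whose points over `closure {η}` ALL satisfy the Frobenius clause (H10 with `U := (closure {η})ᶜ` and goodness over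
  the whole closure — the shape idea-2's relative toric step claims, cf. kit j264805 on probe #1).

So with super-strong steps NO auxiliary measure (δ_F, lex(dim Bad, ·), …) is needed: the number of generization-maximal bad points is
finite (`hDM` ⇒ Bad closed; `BadMaximalPoints.finite_setOf_maximal_of_isClosed`) and drops by at least one at each step
(`BadMaximalPoints.card_maximal_lt_of_superStrongStep`, transport `IsoLocusTransport.fClause_iff_of_isIso_morphismRestrict`), and the
well-founded descent spine `MeasureDescent.genericFInjectivization_of_measure` composes the steps; a maximal non-closed bad point exists
whenever a non-closed bad point does (`MaximalBadPoint.exists_maximal_not_of_exists_not_isClosed`).  (With merely STRONG steps — goodness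
over `η` only — this fails: `StrongStepBadLocus`, docstring.)  No definition is declared; AI-written, weaker than expert review; no
statement of [claim: Hironaka2017] is used. [folklore]
-/

-- single-problem summit: the doubled namespace component `ResolutionOfSingularities` is forced
set_option linter.dupNamespace false

noncomputable section

open CategoryTheory AlgebraicGeometry TopologicalSpace
open Literature.AlgebraicGeometry.Resolution
open Summit.ResolutionOfSingularities.ResolutionOfSingularities.Theorems.FInjectiveMacaulayfication

namespace Summit.ResolutionOfSingularities.ResolutionOfSingularities.Theorems.FInjectiveMacaulayfication.GenericFInjectivizationOfSuperStrongStep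

/-- **Hole #3 ⟸ openness of the F-injective locus + super-strongly confined steps** (registered signatures of `stub_fiLocusOpen` as
hypothesis `hDM` and of `stub_genericFInjectivization` as conclusion, verbatim).  Measure: the number of generization-maximal points at which
the Frobenius clause fails; see the module docstring. [folklore] -/
theorem genericFInjectivization_of_superStrongStep
    (hDM : ∀ (p : ℕ), p.Prime → ∀ (k : Type) [Field k] [CharP k p] (X₁ : Scheme.{0}) (f₁ : X₁ ⟶ Spec (.of k)), LocallyOfFiniteType f₁ → (∀ x : X₁, ∀ d : ℕ, ringKrullDim (X₁.presheaf.stalk x) = d → ∀ s : Fin d → X₁.presheaf.stalk x, (Ideal.span (Set.range s)).radical.IsMaximal → RingTheory.Sequence.IsWeaklyRegular (X₁.presheaf.stalk x) (List.ofFn s)) → IsOpen {x : X₁ | ∀ d : ℕ, ringKrullDim (X₁.presheaf.stalk x) = d → ∀ s : Fin d → X₁.presheaf.stalk x, (Ideal.span (Set.range s)).radical.IsMaximal → ∀ y : X₁.presheaf.stalk x, (∃ e : ℕ, y ^ p ^ e ∈ Ideal.span ((fun z : X₁.presheaf.stalk x => z ^ p ^ e) '' (Ideal.span (Set.range s) :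 Set (X₁.presheaf.stalk x)))) → y ∈ Ideal.span (Set.range s)})
    (step : ∀ (p : ℕ), p.Prime → ∀ (k : Type) [Field k] [CharP k p] (X₁ : Scheme.{0}) (f₁ : X₁ ⟶ Spec (.of k)),
      IsSeparated f₁ → LocallyOfFiniteType f₁ → QuasiCompact f₁ → IsIntegral X₁ →
      (∀ x : X₁, (∀ d : ℕ, ringKrullDim (X₁.presheaf.stalk x) = d → ∀ s : Fin d → X₁.presheaf.stalk x, (Ideal.span (Set.range s)).radical.IsMaximal → RingTheory.Sequence.IsWeaklyRegular (X₁.presheaf.stalk x) (List.ofFn s))) →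
      ∀ η : X₁, ¬ IsClosed ({η} : Set X₁) → ¬ (∀ d : ℕ, ringKrullDim (X₁.presheaf.stalk η) = d → ∀ s : Fin d → X₁.presheaf.stalk η, (Ideal.span (Set.range s)).radical.IsMaximal → ∀ t : X₁.presheaf.stalk η, (∃ e : ℕ, t ^ p ^ e ∈ Ideal.span ((fun z : X₁.presheaf.stalk η => z ^ p ^ e) '' (Ideal.span (Set.range s) : Set (X₁.presheaf.stalk η)))) → t ∈ Ideal.span (Set.range s)) →
        (∀ y : X₁, y ⤳ η → y ≠ η → (∀ d : ℕ, ringKrullDim (X₁.presheaf.stalk y) = d → ∀ s : Fin d → X₁.presheaf.stalk y, (Ideal.span (Set.range s)).radical.IsMaximal → ∀ t : X₁.presheaf.stalk y, (∃ e : ℕ, t ^ p ^ e ∈ Ideal.span ((fun z : X₁.presheaf.stalk y => z ^ p ^ e) '' (Ideal.span (Set.range s) : Set (X₁.presheaf.stalk y)))) → t ∈ Ideal.span (Set.range s))) →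
        ∃ (X₂ : Scheme.{0}) (π : X₂ ⟶ X₁), IsProper π ∧ Literature.AlgebraicGeometry.Resolution.IsBirational π ∧
          IsIntegral X₂ ∧ (∀ x : X₂, (∀ d : ℕ, ringKrullDim (X₂.presheaf.stalk x) = d → ∀ s : Fin d → X₂.presheaf.stalk x, (Ideal.span (Set.range s)).radical.IsMaximal → RingTheory.Sequence.IsWeaklyRegular (X₂.presheaf.stalk x) (List.ofFn s))) ∧
          IsIso (π ∣_ ⟨(closure ({η} : Set X₁))ᶜ, isClosed_closure.isOpen_compl⟩) ∧
          ∀ x : X₂, π.base x ∈ closure ({η} : Set X₁) → (∀ d : ℕ, ringKrullDim (X₂.presheaf.stalk x) = d → ∀ s : Fin d → X₂.presheaf.stalk x, (Ideal.span (Set.range s)).radical.IsMaximal → ∀ t : X₂.presheaf.stalk x, (∃ e : ℕ, t ^ p ^ e ∈ Ideal.span ((fun z : X₂.presheaf.stalk x => z ^ p ^ e) '' (Ideal.span (Set.range s) : Set (X₂.presheaf.stalk x)))) → t ∈ Ideal.span (Set.range s))) :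
    ∀ (p : ℕ), p.Prime → ∀ (k : Type) [Field k] [CharP k p] (X₁ : Scheme.{0}) (f₁ : X₁ ⟶ Spec (.of k)), IsSeparated f₁ → LocallyOfFiniteType f₁ → QuasiCompact f₁ → IsIntegral X₁ → (∀ x : X₁, ∀ d : ℕ, ringKrullDim (X₁.presheaf.stalk x) = d → ∀ s : Fin d → X₁.presheaf.stalk x, (Ideal.span (Set.range s)).radical.IsMaximal → RingTheory.Sequence.IsWeaklyRegular (X₁.presheaf.stalk x) (List.ofFn s)) → ∃ (X₂ : Scheme.{0}) (π : X₂ ⟶ X₁), IsProper π ∧ Literature.AlgebraicGeometry.Resolution.IsBirational π ∧ IsIntegral X₂ ∧ (∀ x : X₂, ∀ d : ℕ, ringKrullDim (X₂.presheaf.stalk x) = d → ∀ s : Fin d → X₂.presheaf.stalk x, (Ideal.span (Set.range s)).radical.IsMaximal → RingTheory.Sequence.IsWeaklyRegular (X₂.presheaf.stalk x) (List.ofFn s)) ∧ ∀ x : X₂, ¬ IsClosed ({x} : Set X₂) → ∀ d : ℕ, ringKrullDim (X₂.presheaf.stalk x) = d → ∀ s : Fin d → X₂.presheaf.stalk x,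 (Ideal.span (Set.range s)).radical.IsMaximal → ∀ y : X₂.presheaf.stalk x, (∃ e : ℕ, y ^ p ^ e ∈ Ideal.span ((fun z : X₂.presheaf.stalk x => z ^ p ^ e) '' (Ideal.span (Set.range s) : Set (X₂.presheaf.stalk x)))) → y ∈ Ideal.span (Set.range s) := by
  refine MeasureDescent.genericFInjectivization_of_measure (W := ℕ) (· < ·) wellFounded_lt
    (fun p k _ X f => Nat.card {ξ : X // ¬ (∀ d : ℕ, ringKrullDim (X.presheaf.stalk ξ) = d → ∀ s : Fin d → X.presheaf.stalk ξ, (Ideal.span (Set.range s)).radical.IsMaximal → ∀ t : X.presheaf.stalk ξ, (∃ e : ℕ, t ^ p ^ e ∈ Ideal.span ((fun z : X.presheaf.stalk ξ => z ^ p ^ e) '' (Ideal.span (Set.range s) : Set (X.presheaf.stalk ξ)))) → t ∈ Ideal.span (Set.range s)) ∧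
      ∀ y : X, ¬ (∀ d : ℕ, ringKrullDim (X.presheaf.stalk y) = d → ∀ s : Fin d → X.presheaf.stalk y, (Ideal.span (Set.range s)).radical.IsMaximal → ∀ t : X.presheaf.stalk y, (∃ e : ℕ, t ^ p ^ e ∈ Ideal.span ((fun z : X.presheaf.stalk y => z ^ p ^ e) '' (Ideal.span (Set.range s) : Set (X.presheaf.stalk y)))) → t ∈ Ideal.span (Set.range s)) → y ⤳ ξ → y = ξ}) ?_
  intro p hp k _ _ X f hsep hft hqc hint hCM hbad
  haveI : Fact p.Prime := ⟨hp⟩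
  haveI := hft
  haveI := hqc
  -- a maximal non-closed bad point
  obtain ⟨η, hηnc, hηbad, hηmax⟩ := MaximalBadPoint.exists_maximal_not_of_exists_not_isClosed f
    (fun x : X => (∀ d : ℕ, ringKrullDim (X.presheaf.stalk x) = d → ∀ s : Fin d → X.presheaf.stalk x, (Ideal.span (Set.range s)).radical.IsMaximal → ∀ t : X.presheaf.stalk x, (∃ e : ℕ, t ^ p ^ e ∈ Ideal.span ((fun z : X.presheaf.stalk x => z ^ p ^ e) '' (Ideal.span (Set.range s) : Set (X.presheaf.stalk x)))) → t ∈ Ideal.span (Set.range s))) hbad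
  -- the step at `η`
  obtain ⟨X₂, π, hπ, hbir, hint₂, hCM₂, hiso, hgood⟩ :=
    step p hp k X f hsep hft hqc hint hCM η hηnc hηbad hηmax
  refine ⟨X₂, π, hπ, hbir, hint₂, hCM₂, ?_⟩
  -- the bad locus of `X` is closed (Datta–Murayama)
  have hopen := hDM p hp k X f hft hCM
  have hclosed : IsClosed {x : X | ¬ (∀ d : ℕ, ringKrullDim (X.presheaf.stalk x) = d → ∀ s : Fin d → X.presheaf.stalk x, (Ideal.span (Set.range s)).radical.IsMaximal → ∀ t : X.presheaf.stalk x, (∃ e : ℕ, t ^ p ^ e ∈ Ideal.span ((fun z : X.presheaf.stalk x => z ^ p ^ e) '' (Ideal.span (Set.range s) : Set (X.presheaf.stalk x)))) → t ∈ Ideal.span (Set.range s))} := by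
    rw [← isOpen_compl_iff]
    convert hopen using 1
    ext x
    simp only [Set.mem_compl_iff, Set.mem_setOf_eq, not_not]
  -- `X` is a Noetherian sober `T₀` space
  haveI : IsLocallyNoetherian X := LocallyOfFiniteType.isLocallyNoetherian f
  haveI : CompactSpace X := QuasiCompact.compactSpace_of_compactSpace f
  haveI : IsNoetherian X := {}
  have hfin := BadMaximalPoints.finite_setOf_maximal_of_isClosed hclosed
  -- the count drop
  haveI := hiso
  refine BadMaximalPoints.card_maximal_lt_of_superStrongStep π η
    ⟨(closure ({η} : Set X))ᶜ, isClosed_closure.isOpen_compl⟩ rfl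
    (fun y : X => ¬ (∀ d : ℕ, ringKrullDim (X.presheaf.stalk y) = d → ∀ s : Fin d → X.presheaf.stalk y, (Ideal.span (Set.range s)).radical.IsMaximal → ∀ t : X.presheaf.stalk y, (∃ e : ℕ, t ^ p ^ e ∈ Ideal.span ((fun z : X.presheaf.stalk y => z ^ p ^ e) '' (Ideal.span (Set.range s) : Set (X.presheaf.stalk y)))) → t ∈ Ideal.span (Set.range s)))
    (fun x : X₂ => ¬ (∀ d : ℕ, ringKrullDim (X₂.presheaf.stalk x) = d → ∀ s : Fin d → X₂.presheaf.stalk x, (Ideal.span (Set.range s)).radical.IsMaximal → ∀ t : X₂.presheaf.stalk x, (∃ e : ℕ, t ^ p ^ e ∈ Ideal.span ((fun z : X₂.presheaf.stalk x => z ^ p ^ e) '' (Ideal.span (Set.range s) : Set (X₂.presheaf.stalk x)))) → t ∈ Ideal.span (Set.range s)))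
    (fun x hx => not_congr (IsoLocusTransport.fClause_iff_of_isIso_morphismRestrict p π _ x hx).symm)
    (fun x hx hb => hb (hgood x hx)) ⟨hηbad, fun y hy hsp => ?_⟩ ?_
  · by_contra hne
    exact hy (hηmax y hsp hne)
  · simpa only [Set.mem_setOf_eq] using hfin

end Summit.ResolutionOfSingularities.ResolutionOfSingularities.Theorems.FInjectiveMacaulayfication.GenericFInjectivizationOfSuperStrongStep

end
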